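import Summits.Parity.GeneralizedHardyLittlewood.Theorems.FordMaynardNoSieveConst0164NegWitness0164ClosedRanges

/-!
# Route `FordMaynardNoSieveConst0164`, crux `NegWitness0164` (stmt-Parity-19102), line `birth`,
# stub `stub_tweakNeg0164`: enclosure layer — per-cell polynomial bounds of (II') (part 38)

Helper file toward the certificate stub (K. Ford, J. Maynard, *On the theory of prime producing sieves*,
arXiv:2407.14368, §8), generated (scripts/gen_cells.py of the -1 lineage, gen4).  For the LINK step
`(α/6) Σ_τ lpCoeff0164(τ,j)·F_τ(α) ≤ P_{j,σ}(α)` of the 36 frozen-cell families: for each ordered cell index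
`τ = (τ₀,τ₁,τ₂)` occurring in a pinned support (`…PinnedImages*`) and each range of `s = (α − Σ_k e_{τ_k})/w`
(`e_t = 41/250 + 7t/500`, `w = 7/500`) met on a lattice piece, the cell integral
`F_τ(α) = ∫_{Δ₃(α)} 𝟙[cell τ]/(v₀v₁v₂)` is bounded by an EXPLICIT polynomial in `α` with exact rational coefficients
(`cell_integral_le_trinomial_0164` of `…CellTrinomial`, then `trinomial_box_integral_range_one_closed/two_closed/three_0164`
of `…ClosedRanges`/`…TrinomialRanges`, then `ring`), or by `0` off range (`…CellPolyRanges`).  Summed with the table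
weights these polynomials are exactly the piece polynomials of `…PiecesF*` (checked exactly, scripts/compare.py).

Def-free (generated).  References: [FordMaynard2024PrimeSieves] arXiv:2407.14368, §8 (proof of Theorem 2.7 (c)).
-/

noncomputable section

open Finset MeasureTheory Set
open scoped Classical
open Literature.NumberTheory.Sieve Literature.NumberTheory.Sieve.FordMaynard

namespace Summit.Parity.GeneralizedHardyLittlewood.FordMaynardNoSieveConst0164NegWitness0164

/-- Cell `(9,1,1)` (corners `41/250 + 7τ_k/500`), range 1 (`α ∈ [323/500, 33/50]`, `s ∈ [0,1]`): the cell integral of (II') is at most the explicit polynomial (Taylor majorant × exact section moments; chain `cell_integral_le_trinomial_0164` → `trinomial_box_integral_range_*`). [cite: FordMaynard2024PrimeSieves, §8 (proof of Theorem 2.7 (c))] -/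
theorem cell_9_1_1_r1_le_0164 {α : ℝ} (h1 : (323 / 500 : ℝ) ≤ α) (h2 : α ≤ (33 / 50 : ℝ)) :
    sliceIntegral 3 α (fun v : Fin 3 → ℝ => if ∀ i, (41 / 250 + ((![9, 1, 1] : Fin 3 → Fin 24) i : ℕ) * (7 / 500) : ℝ) ≤ v i ∧
        v i < 41 / 250 + (((![9, 1, 1] : Fin 3 → Fin 24) i : ℕ) + 1) * (7 / 500) then 1 / (v 0 * v 1 * v 2) else 0) ≤
      (160792506439825974765586 / 299053141220800110375 : ℝ) + (-(1021949183957293640528 / 265825014418488987) : ℝ) * α + (4025708957738684420000 / 341775018538057269 : ℝ) * α ^ 2 + (-(630443794823504000000 / 31070456230732479) : ℝ) * α ^ 3 + (821810587010000000000 / 37975002059784141 : ℝ) * α ^ 4 + (-(5051359864000000000000 / 341775018538057269) : ℝ) * α ^ 5 + (2190446000000000000000 / 341775018538057269 : ℝ) * α ^ 6 + (-(40000000000000000000 / 24165910401680817) : ℝ) * α ^ 7 + (500000000000000000000 / 2392425129766400883 : ℝ) * α ^ 8 := by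
  refine (cell_integral_le_trinomial_0164 _ α).trans ?_
  obtain ⟨e0, e1, e2⟩ : (((![9, 1, 1] : Fin 3 → Fin 24) 0 : Fin 24) : ℕ) = 9 ∧ (((![9, 1, 1] : Fin 3 → Fin 24) 1 : Fin 24) : ℕ) = 1 ∧ (((![9, 1, 1] : Fin 3 → Fin 24) 2 : Fin 24) : ℕ) = 1 := by decide
  simp only [Fin.sum_univ_three, Fin.isValue, e0, e1, e2, Nat.cast_one, Nat.cast_ofNat]
  rw [trinomial_box_integral_range_one_closed_0164 _ _ _ _ _ _ _ _ _ (by linarith) (by linarith)]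
  exact le_of_eq (by ring)

end Summit.Parity.GeneralizedHardyLittlewood.FordMaynardNoSieveConst0164NegWitness0164

end
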